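import Summits.BirchSwinnertonDyer.Rank1Residual.X2.DualRestrictionInvariants
import Literature.NumberTheory.EllipticCurves.IwasawaSelmerIsTorsionProofs
import HarnessLib

/-!
# Route `TwoAdicConverse` (rung S3), crux `OrdLambdaHalfAtTwo` (item stmt-BirchSwinnertonDyer-19556), line
# `kato-determinant-greenberg-two`: the registered stub `stub_poitouTateTwoWaysAtTwo` («hPT — Poitou–Tate
# counted two ways») AS PURE `Λ`-MODULE ALGEBRA

Cell `bsd-2adic`, seat `bsd-2adic-conv-1` GEN 24 (`--supports` stmt-BirchSwinnertonDyer-19556; helper).  The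
skeleton `Cruxes/OrdLambdaHalfAtTwo/Lines/kato_determinant_greenberg_two.lean` (crux-plan seat, skeleton
`037466d7c4ab`, registered 2026-08-28T17:58Z) reduces the `λ`-half of the `2`-adic main conjecture on the
rational-`2`-torsion stratum (β) to six stubs; its stub 5 asks, for ANY «Kato–Greenberg datum»

* `Λ`-modules `HW, HA` (global Iwasawa cohomology of `T₂E`, `T₂E^K` over `ℚ_∞`), `Hl` (`H¹_Iw(K_w,T)`, finitely
  generated), localisations `locW : HW → Hl`, `locA : HA → Hl` with `locW ⊕ locA` INJECTIVE, zeta submodules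
  `ZW ≤ HW`, `ZA ≤ HA` with `Hl ⧸ (locW ZW + locA ZA)` TORSION (the «Kato determinant» is non-zero),
* the Poitou–Tate short exact sequence `0 → Hl ⧸ loc(HW ⊕ HA) →δ X_Gr →π X_fine → 0` with `X_Gr` finitely
  generated and torsion,
* Kato's index identity `λ(HW⧸ZW) + λ(HA⧸ZA) + (b + b') = λ(X_fine) + (a + a')`,

the identity **`λ(X_Gr) + (a + a') = λ(Hl ⧸ (locW ZW + locA ZA)) + (b + b')`**.  This file PROVES it, with the
structures of the skeleton UNFOLDED into their fields (a Theorems file cannot import a `Cruxes/` module), so that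
the stub becomes the one-liner
`fun KG h => lambda_poitouTate_twoWays 2 KG.locW KG.locA KG.ZW KG.ZA KG.loc_injective KG.isTorsion_quot KG.δ
KG.δ_injective KG.π KG.π_surjective KG.exact_δ_π KG.katoIndex h.1 h.2` (with `KG.finiteHl` as instance).

Mechanism (Washington §13.2; Greenberg LNM 1716 §1 «`λ = dim_{ℚ_p} X ⊗ ℚ_p`»): `λ` is additive on short exact
sequences of finitely generated torsion `Λ`-modules (tree: `lambdaInvariant_eq_add_of_surjective`, flat base
change to `ℚ_p`) and invariant under `Λ`-isomorphisms (tree: `lambdaInvariant_eq_of_linearEquiv`); `Λ = ℤ_p⟦T⟧`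
is Noetherian, so every sub-quotient met is again finitely generated.  Three counts:
(A) `λ(X_Gr) = λ(Hl⧸R) + λ(X_fine)` with `R = range (locW ⊕ locA)` (`ker π = range δ ≅ Hl⧸R`);
(B) `λ(Hl⧸Z') = λ(R⧸Z') + λ(Hl⧸R)` with `Z' = locW ZW + locA ZA ≤ R` (third isomorphism theorem);
(C) `R⧸Z' ≅ (HW ⊕ HA)⧸(ZW ⊕ ZA) ≅ HW⧸ZW ⊕ HA⧸ZA` (injectivity of `locW ⊕ locA`), `λ` of a product is the sum.

HONEST FRAMING.  Generic commutative algebra, valid at every prime `p` (stated for all `p`, used at `p = 2`);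
nothing about elliptic curves is asserted, no named fact is used, no item is closed; the stub's arithmetic
content (the EXISTENCE of such a datum with the true shadows, stub 4, and the Greenberg divisibility, stub 6)
is untouched.  BSD is not proved by any of this.  PARTITION (D-0054): none — RANK axis S3 × X5@2 stratum (β).

References: L. Washington, *Introduction to Cyclotomic Fields*, §13.2 [Washington1997]; R. Greenberg,
LNM 1716 (1999), §1 [GreenbergLNM1716]; K. Kato, Astérisque 295 (2004), Thm 12.5, §17.13 [Kato2004Asterisque].
-/

set_option linter.dupNamespace false
set_option autoImplicit false

noncomputable section

open Function Literature.NumberTheory.EllipticCurves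
  Summit.BirchSwinnertonDyer.Rank1Residual.X2.DualRestrictionInvariants

namespace Summit.BirchSwinnertonDyer.BirchSwinnertonDyer.Theorems.TwoAdicPoitouTateTwoWays

universe u v w

variable (p : ℕ) [Fact p.Prime]

/-! ## §1 Generic `λ`-bookkeeping over `Λ = ℤ_p⟦T⟧` -/

section Generic

variable {A : Type u} {B : Type v} {C : Type w}
  [AddCommGroup A] [Module (IwasawaAlgebra p) A]
  [AddCommGroup B] [Module (IwasawaAlgebra p) B]
  [AddCommGroup C] [Module (IwasawaAlgebra p) C]

/-- A `Λ`-module that injects into a torsion `Λ`-module is torsion. [folklore] -/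
theorem isTorsion_of_injective (f : A →ₗ[IwasawaAlgebra p] B) (hf : Injective f)
    (hB : Module.IsTorsion (IwasawaAlgebra p) B) : Module.IsTorsion (IwasawaAlgebra p) A := by
  intro x
  obtain ⟨a, ha⟩ := @hB (f x)
  refine ⟨a, hf ?_⟩
  rw [map_zero, Submonoid.smul_def, map_smul]
  exact ha

/-- A quotient of a torsion `Λ`-module is torsion. [folklore] -/
theorem isTorsion_of_surjective (g : B →ₗ[IwasawaAlgebra p] C) (hg : Surjective g)
    (hB : Module.IsTorsion (IwasawaAlgebra p) B) : Module.IsTorsion (IwasawaAlgebra p) C := by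
  intro y
  obtain ⟨x, rfl⟩ := hg y
  obtain ⟨a, ha⟩ := @hB x
  refine ⟨a, ?_⟩
  rw [Submonoid.smul_def, ← map_smul, ← Submonoid.smul_def, ha, map_zero]

/-- **`λ` is additive on short exact sequences** `0 → A → B → C → 0` of `Λ`-modules with `B` finitely
generated and torsion: `λ(B) = λ(A) + λ(C)` (tree `lambdaInvariant_eq_add_of_surjective` for `ker g`, and
`A ≅ ker g`). (Washington §13.2.) [cite: Washington1997, §13.2] -/
theorem lambdaInvariant_eq_add_of_exact [Module.Finite (IwasawaAlgebra p) B]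
    (hB : Module.IsTorsion (IwasawaAlgebra p) B)
    (f : A →ₗ[IwasawaAlgebra p] B) (g : B →ₗ[IwasawaAlgebra p] C)
    (hf : Injective f) (hg : Surjective g) (hfg : Exact f g) :
    lambdaInvariant p B = lambdaInvariant p A + lambdaInvariant p C := by
  have h := lambdaInvariant_eq_add_of_surjective p g hB hg
  have e : A ≃ₗ[IwasawaAlgebra p] LinearMap.ker g :=
    (LinearEquiv.ofInjective f hf).trans (LinearEquiv.ofEq _ _ hfg.linearMap_ker_eq.symm)
  rw [h, lambdaInvariant_eq_of_linearEquiv e]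

/-- **`λ` of a product**: for `A × C` finitely generated and torsion, `λ(A × C) = λ(A) + λ(C)`.
(Washington §13.2.) [cite: Washington1997, §13.2] -/
theorem lambdaInvariant_prod [Module.Finite (IwasawaAlgebra p) (A × C)]
    (h : Module.IsTorsion (IwasawaAlgebra p) (A × C)) :
    lambdaInvariant p (A × C) = lambdaInvariant p A + lambdaInvariant p C :=
  lambdaInvariant_eq_add_of_exact p h (LinearMap.inl (IwasawaAlgebra p) A C)
    (LinearMap.snd (IwasawaAlgebra p) A C) LinearMap.inl_injective LinearMap.snd_surjective
    Function.Exact.inl_snd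

end Generic

/-! ## §2 Nested quotients: `λ(M⧸S) = λ(T⧸S) + λ(M⧸T)` for `S ≤ T` -/

section Nested

variable {M : Type u} [AddCommGroup M] [Module (IwasawaAlgebra p) M]

/-- **Third isomorphism theorem in `λ`-currency**: for submodules `S ≤ T` of `M` with `M ⧸ S` finitely
generated and torsion, `λ(M⧸S) = λ(T.map S.mkQ) + λ(M⧸T)` (`(M⧸S)⧸(T⧸S) ≅ M⧸T`). [cite: Washington1997, §13.2] -/
theorem lambdaInvariant_quotient_eq_add (S T : Submodule (IwasawaAlgebra p) M) (hST : S ≤ T)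
    [Module.Finite (IwasawaAlgebra p) (M ⧸ S)] (h : Module.IsTorsion (IwasawaAlgebra p) (M ⧸ S)) :
    lambdaInvariant p (M ⧸ S) =
      lambdaInvariant p (T.map S.mkQ) + lambdaInvariant p (M ⧸ T) := by
  have h1 := lambdaInvariant_eq_add_of_surjective p (T.map S.mkQ).mkQ h (Submodule.mkQ_surjective _)
  rw [h1, lambdaInvariant_eq_of_linearEquiv (LinearEquiv.ofEq _ _ (Submodule.ker_mkQ _)),
    lambdaInvariant_eq_of_linearEquiv (Submodule.quotientQuotientEquivQuotient S T hST)]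

end Nested

/-! ## §3 The Kato-determinant configuration: `loc(HW ⊕ HA) ⧸ (loc ZW + loc ZA) ≅ HW⧸ZW ⊕ HA⧸ZA` -/

section Determinant

variable {HW : Type u} {HA : Type v} {Hl : Type w}
  [AddCommGroup HW] [Module (IwasawaAlgebra p) HW]
  [AddCommGroup HA] [Module (IwasawaAlgebra p) HA]
  [AddCommGroup Hl] [Module (IwasawaAlgebra p) Hl]
  (locW : HW →ₗ[IwasawaAlgebra p] Hl) (locA : HA →ₗ[IwasawaAlgebra p] Hl)
  (ZW : Submodule (IwasawaAlgebra p) HW) (ZA : Submodule (IwasawaAlgebra p) HA)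

/-- `loc ZW + loc ZA ≤ range (locW ⊕ locA)`. [folklore] -/
theorem map_sup_map_le_range_coprod :
    ZW.map locW ⊔ ZA.map locA ≤ LinearMap.range (locW.coprod locA) := by
  rw [LinearMap.range_coprod]
  exact sup_le_sup LinearMap.map_le_range LinearMap.map_le_range

/-- If `locW ⊕ locA : HW × HA → Hl` is injective, the preimage of `loc ZW + loc ZA` is exactly `ZW × ZA`:
the kernel of `HW × HA → Hl ⧸ (loc ZW + loc ZA)` is `ZW.prod ZA`. [folklore] -/
theorem ker_mkQ_comp_coprod (hloc : Injective (locW.coprod locA)) :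
    LinearMap.ker ((ZW.map locW ⊔ ZA.map locA).mkQ ∘ₗ locW.coprod locA) = ZW.prod ZA := by
  rw [LinearMap.ker_comp, Submodule.ker_mkQ]
  ext ⟨x, y⟩
  simp only [Submodule.mem_comap, LinearMap.coprod_apply, Submodule.mem_prod]
  constructor
  · intro hxy
    obtain ⟨u, hu, v, hv, huv⟩ := Submodule.mem_sup.1 hxy
    obtain ⟨zW, hzW, rfl⟩ := Submodule.mem_map.1 hu
    obtain ⟨zA, hzA, rfl⟩ := Submodule.mem_map.1 hv
    have hxy' : (locW.coprod locA) (zW, zA) = (locW.coprod locA) (x, y) := by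
      simpa only [LinearMap.coprod_apply] using huv
    have hpair := hloc hxy'
    rw [Prod.mk.injEq] at hpair
    obtain ⟨rfl, rfl⟩ := hpair
    exact ⟨hzW, hzA⟩
  · rintro ⟨hx, hy⟩
    exact Submodule.add_mem_sup (Submodule.mem_map_of_mem hx) (Submodule.mem_map_of_mem hy)

/-- **The range of `loc(HW ⊕ HA)` in `Hl ⧸ (loc ZW + loc ZA)` is isomorphic to `HW⧸ZW × HA⧸ZA`** (for
`locW ⊕ locA` injective): `(HW × HA) ⧸ (ZW × ZA)` is both (first isomorphism theorem for
`HW × HA → Hl ⧸ (loc ZW + loc ZA)`, whose kernel is `ZW × ZA`, and for the product of the quotient maps).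
Stated as `Nonempty` (an existence THEOREM: only `λ` is read through it). [folklore] -/
theorem nonempty_rangeMapMkQ_equiv_prod (hloc : Injective (locW.coprod locA)) :
    Nonempty (↥((LinearMap.range (locW.coprod locA)).map (ZW.map locW ⊔ ZA.map locA).mkQ)
      ≃ₗ[IwasawaAlgebra p] (HW ⧸ ZW) × (HA ⧸ ZA)) := by
  refine ⟨?_⟩
  let Z' := ZW.map locW ⊔ ZA.map locA
  let φ : HW × HA →ₗ[IwasawaAlgebra p] Hl ⧸ Z' := Z'.mkQ ∘ₗ locW.coprod locA
  have hrange : LinearMap.range φ = (LinearMap.range (locW.coprod locA)).map Z'.mkQ :=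
    LinearMap.range_comp _ _
  have hker : LinearMap.ker φ = ZW.prod ZA := ker_mkQ_comp_coprod p locW locA ZW ZA hloc
  -- `(HW × HA) ⧸ (ZW × ZA) ≃ HW⧸ZW × HA⧸ZA`
  let ψ : HW × HA →ₗ[IwasawaAlgebra p] (HW ⧸ ZW) × (HA ⧸ ZA) := ZW.mkQ.prodMap ZA.mkQ
  have hψ : Surjective ψ := (Submodule.mkQ_surjective ZW).prodMap (Submodule.mkQ_surjective ZA)
  have hkerψ : LinearMap.ker ψ = ZW.prod ZA := by
    rw [LinearMap.ker_prodMap, Submodule.ker_mkQ, Submodule.ker_mkQ]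
  exact (LinearEquiv.ofEq _ _ hrange.symm).trans
    ((φ.quotKerEquivRange.symm.trans (Submodule.quotEquivOfEq _ _ (hker.trans hkerψ.symm))).trans
      (ψ.quotKerEquivOfSurjective hψ))

end Determinant

/-! ## §4 The stub: Poitou–Tate counted two ways -/

section Main

variable {HW : Type u} {HA : Type v} {Hl : Type w} {X Xf : Type}
  [AddCommGroup HW] [Module (IwasawaAlgebra p) HW]
  [AddCommGroup HA] [Module (IwasawaAlgebra p) HA]
  [AddCommGroup Hl] [Module (IwasawaAlgebra p) Hl]
  [AddCommGroup X] [Module (IwasawaAlgebra p) X]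
  [AddCommGroup Xf] [Module (IwasawaAlgebra p) Xf]

/-- **hPT — Poitou–Tate counted two ways, as PID algebra** (the registered stub `stub_poitouTateTwoWaysAtTwo` of
line `kato-determinant-greenberg-two`, crux `OrdLambdaHalfAtTwo`, with the skeleton's structures unfolded).
Data: `locW : HW → Hl`, `locA : HA → Hl` with `locW ⊕ locA` injective, `Hl` finitely generated, zeta submodules
`ZW, ZA` with `Hl ⧸ (loc ZW + loc ZA)` torsion, the Poitou–Tate short exact sequence
`0 → Hl ⧸ range(locW ⊕ locA) →δ X →π Xf → 0` with `X` finitely generated torsion, and Kato's index identity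
`λ(HW⧸ZW) + λ(HA⧸ZA) + (b + b') = λ(Xf) + (a + a')`.  Conclusion:
`λ(X) + (a + a') = λ(Hl ⧸ (loc ZW + loc ZA)) + (b + b')`.
Proof: (A) `λ(X) = λ(Hl⧸R) + λ(Xf)`; (B) `λ(Hl⧸Z') = λ(R⧸Z') + λ(Hl⧸R)`; (C) `λ(R⧸Z') = λ(HW⧸ZW) + λ(HA⧸ZA)`;
add Kato's identity.  (Washington §13.2; Greenberg LNM 1716 §1; the bookkeeping of Kato 2004 §17.13 ⊗ ℚ.)
[cite: Washington1997, §13.2] [cite: GreenbergLNM1716, §1] -/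
theorem lambda_poitouTate_twoWays [Module.Finite (IwasawaAlgebra p) Hl]
    (locW : HW →ₗ[IwasawaAlgebra p] Hl) (locA : HA →ₗ[IwasawaAlgebra p] Hl)
    (ZW : Submodule (IwasawaAlgebra p) HW) (ZA : Submodule (IwasawaAlgebra p) HA)
    (hloc : Injective (locW.coprod locA))
    (htor : Module.IsTorsion (IwasawaAlgebra p) (Hl ⧸ (ZW.map locW ⊔ ZA.map locA)))
    (δ : (Hl ⧸ LinearMap.range (locW.coprod locA)) →ₗ[IwasawaAlgebra p] X) (hδ : Injective δ)
    (π : X →ₗ[IwasawaAlgebra p] Xf) (hπ : Surjective π) (hex : Exact δ π)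
    {a a' b b' : ℕ}
    (hKato : lambdaInvariant p (HW ⧸ ZW) + lambdaInvariant p (HA ⧸ ZA) + (b + b') =
      lambdaInvariant p Xf + (a + a'))
    (hXfin : Module.Finite (IwasawaAlgebra p) X) (hXtor : Module.IsTorsion (IwasawaAlgebra p) X) :
    lambdaInvariant p X + (a + a') =
      lambdaInvariant p (Hl ⧸ (ZW.map locW ⊔ ZA.map locA)) + (b + b') := by
  haveI : IsNoetherianRing (IwasawaAlgebra p) := inferInstance
  haveI := hXfin
  have hZ'R : ZW.map locW ⊔ ZA.map locA ≤ LinearMap.range (locW.coprod locA) :=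
    map_sup_map_le_range_coprod p locW locA ZW ZA
  -- (A) `λ(X) = λ(Hl⧸R) + λ(Xf)`, `R = range (locW ⊕ locA)`
  have hA : lambdaInvariant p X =
      lambdaInvariant p (Hl ⧸ LinearMap.range (locW.coprod locA)) + lambdaInvariant p Xf :=
    lambdaInvariant_eq_add_of_exact p hXtor δ π hδ hπ hex
  -- (B) `λ(Hl⧸Z') = λ(R.map Z'.mkQ) + λ(Hl⧸R)`, `Z' = loc ZW + loc ZA`
  have hB : lambdaInvariant p (Hl ⧸ (ZW.map locW ⊔ ZA.map locA)) =
      lambdaInvariant p ↥((LinearMap.range (locW.coprod locA)).map (ZW.map locW ⊔ ZA.map locA).mkQ) +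
        lambdaInvariant p (Hl ⧸ LinearMap.range (locW.coprod locA)) :=
    lambdaInvariant_quotient_eq_add p _ _ hZ'R htor
  -- (C) `λ(R.map Z'.mkQ) = λ(HW⧸ZW) + λ(HA⧸ZA)`
  obtain ⟨e⟩ := nonempty_rangeMapMkQ_equiv_prod p locW locA ZW ZA hloc
  haveI : IsNoetherian (IwasawaAlgebra p) (Hl ⧸ (ZW.map locW ⊔ ZA.map locA)) :=
    isNoetherian_of_isNoetherianRing_of_finite _ _
  haveI : Module.Finite (IwasawaAlgebra p)
      ↥((LinearMap.range (locW.coprod locA)).map (ZW.map locW ⊔ ZA.map locA).mkQ) :=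
    Module.Finite.of_injective (Submodule.subtype _) (Submodule.subtype_injective _)
  haveI : Module.Finite (IwasawaAlgebra p) ((HW ⧸ ZW) × (HA ⧸ ZA)) := Module.Finite.equiv e
  have htorSub : Module.IsTorsion (IwasawaAlgebra p)
      ↥((LinearMap.range (locW.coprod locA)).map (ZW.map locW ⊔ ZA.map locA).mkQ) :=
    isTorsion_of_injective p (Submodule.subtype _) (Submodule.subtype_injective _) htor
  have htorProd : Module.IsTorsion (IwasawaAlgebra p) ((HW ⧸ ZW) × (HA ⧸ ZA)) :=
    isTorsion_of_surjective p e.toLinearMap e.surjective htorSub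
  have hC : lambdaInvariant p
      ↥((LinearMap.range (locW.coprod locA)).map (ZW.map locW ⊔ ZA.map locA).mkQ) =
        lambdaInvariant p (HW ⧸ ZW) + lambdaInvariant p (HA ⧸ ZA) := by
    rw [lambdaInvariant_eq_of_linearEquiv e, lambdaInvariant_prod p htorProd]
  omega

end Main

end Summit.BirchSwinnertonDyer.BirchSwinnertonDyer.Theorems.TwoAdicPoitouTateTwoWays

end
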